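import Summits.RiemannHypothesis.RiemannHypothesis.Theses.SpectralTrace
import Summits.RiemannHypothesis.RiemannHypothesis.Theorems.WindowTraceArch.Negative.LocalWeyl
import Mathlib.Analysis.Distribution.AEEqOfIntegralContDiff
import HarnessLib

/-!
# `WindowStep` — negative lemma: finitely many moves never perform the step

Refuter (crux disprover) record for the crux `stmt-RiemannHypothesis-14659`
(`Summit.RiemannHypothesis.RiemannHypothesis.Theses.SpectralTrace.WindowStep`, the collar-healing
step `Trace(log n) → Trace(log (n+1))`). The crux text heals the collar defect by "moving/adding
atoms … with a BOUNDED real displacement", the foreseen sub-items split it into a finite "bottom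
block" and a far field. This file proves, unconditionally and with no arithmetic input, that the
finite part alone can never do it:

* `multiset_eq_of_sum_weilMellin_eq` (**core, exponential-sum uniqueness from window tests**):
  two finite real multisets `{a_k}`, `{b_k}` with `Σ_k ĝ(½ + i a_k) = Σ_k ĝ(½ + i b_k)` for every
  Weil test `g` supported in `[-A, A]` (`A > 0`) are EQUAL. Proof: the exponential polynomial
  `P(t) = Σ_k (e^{i a_k t} − e^{i b_k t})` integrates to `0` against every smooth `g` supported in
  `(−A, A)`, so `P = 0` a.e. there (`IsOpen.ae_eq_zero_of_integral_contDiff_smul_eq_zero`), hence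
  on `(−A, A)` by continuity, hence on `ℝ` by analytic continuation, hence coefficient-wise by
  Dedekind's independence of characters (`linearIndependent_monoidHom`): equal multiplicities.
* `multiset_eq_of_finite_moves`: if two window families `γ, γ' : ι → ℝ` on the same window
  `[-A, A]` agree outside a finite set `F` of indices, they agree on `F` as multisets — a finite
  relocation of atoms that keeps the rung is a PERMUTATION of the atoms;
* `hasSum_iff_of_finite_moves`: consequently `γ` and `γ'` have the same trace on EVERY function
  (any window): `no_windowStep_by_finite_moves` — if the rung-`A` family is not a rung-`B` family,
  no finite modification of it is;
* `no_windowStep_below_height`: by local finiteness of window families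
  (`finite_abs_le_of_windowTrace`, landed) a modification confined to the atoms of height `≤ R`
  is finite, so **the step cannot be performed below any finite height**: every genuine healing
  `Trace(log n) → Trace(log (n+1))` changes atoms of arbitrarily large height (with `Nested.lean`:
  it both removes and adds atoms).
-/

set_option linter.dupNamespace false

noncomputable section

open Complex Set Filter MeasureTheory
open scoped Real Topology ContDiff

namespace Summit.RiemannHypothesis.RiemannHypothesis.Theorems.WindowStep.Negative

open Literature.NumberTheory.LFunctions
open Summit.RiemannHypothesis.RiemannHypothesis.Theses.SpectralTrace
open Summit.RiemannHypothesis.RiemannHypothesis.Theorems.WindowTraceArch.Negative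

/-! ### Exponential sums -/

/-- `t ↦ e^{ixt}` (`x` real) is real-analytic on `ℝ` as a `ℂ`-valued map. [folklore] -/
theorem analyticOnNhd_cexp_mul_I (x : ℝ) :
    AnalyticOnNhd ℝ (fun t : ℝ => cexp ((x : ℂ) * I * (t : ℂ))) univ := by
  intro t _
  have hin : AnalyticAt ℝ (fun t : ℝ => (x : ℂ) * I * (t : ℂ)) t :=
    analyticAt_const.mul (Complex.ofRealCLM.analyticAt t)
  have hexp : AnalyticAt ℝ cexp ((x : ℂ) * I * (t : ℂ)) :=
    (analyticOnNhd_cexp _ (mem_univ _)).restrictScalars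
  exact AnalyticAt.comp (g := cexp) (f := fun t : ℝ => (x : ℂ) * I * (t : ℂ)) hexp hin

/-- Transform of a Weil test on the critical line: `ĝ(1/2 + ix) = ∫ g(t) e^{ixt} dt`.
[folklore] -/
theorem weilMellin_half_eq_integral (g : ℝ → ℂ) (x : ℝ) :
    weilMellin g (1 / 2 + (x : ℂ) * I) = ∫ t : ℝ, g t * cexp ((x : ℂ) * I * (t : ℂ)) := by
  simp only [weilMellin, add_sub_cancel_left]

/-- A finite exponential sum against a Weil test: `Σ_k ĝ(1/2 + i a_k) = ∫ g · Σ_k e^{i a_k ·}`.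
[folklore] -/
theorem sum_weilMellin_half_eq_integral {g : ℝ → ℂ} (hg : IsWeilTest g) {κ : Type*}
    (F : Finset κ) (a : κ → ℝ) :
    ∑ k ∈ F, weilMellin g (1 / 2 + (a k : ℂ) * I) =
      ∫ t : ℝ, g t * ∑ k ∈ F, cexp ((a k : ℂ) * I * (t : ℂ)) := by
  simp_rw [weilMellin_half_eq_integral, Finset.mul_sum]
  rw [integral_finsetSum]
  intro k _
  exact (hg.1.continuous.mul (by fun_prop)).integrable_of_hasCompactSupport hg.2.mul_right

/-- Distinct frequencies give distinct characters: `e^{ixt} = e^{iyt}` for all `t` forces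
`x = y`. [folklore] -/
theorem eq_of_cexp_mul_I_eq {x y : ℝ}
    (h : ∀ t : ℝ, cexp ((x : ℂ) * I * (t : ℂ)) = cexp ((y : ℂ) * I * (t : ℂ))) : x = y := by
  by_contra hxy
  have hd : x - y ≠ 0 := sub_ne_zero.2 hxy
  set t : ℝ := π / (x - y) with ht
  have h1 := h t
  rw [Complex.exp_eq_exp_iff_exists_int] at h1
  obtain ⟨n, hn⟩ := h1
  -- `(x - y) t = 2π n`, i.e. `π = 2π n`
  have h2 : ((x : ℂ) * I * (t : ℂ)) - ((y : ℂ) * I * (t : ℂ)) = n * (2 * π * I) := by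
    rw [hn]; ring
  have h3 : (((x - y) * t : ℝ) : ℂ) * I = ((2 * π * n : ℝ) : ℂ) * I := by
    push_cast
    linear_combination h2
  have h4 : (x - y) * t = 2 * π * n := by
    have := mul_right_cancel₀ I_ne_zero h3
    exact_mod_cast this
  have h5 : (x - y) * t = π := by rw [ht]; field_simp
  have h6 : (1 : ℝ) = 2 * (n : ℝ) := by
    have := h4.symm.trans h5
    have hπ : π ≠ 0 := Real.pi_ne_zero
    field_simp at this
    linarith
  have h7 : (1 : ℤ) = 2 * n := by exact_mod_cast h6
  omega

/-- **Core: exponential-sum uniqueness from window tests.** If two finite real multisets have the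
same trace `Σ ĝ(1/2 + i·)` on every Weil test supported in `[-A, A]` (`A > 0`), they are equal.
[folklore] -/
theorem multiset_eq_of_sum_weilMellin_eq {A : ℝ} (hA : 0 < A) {κ : Type*} (F : Finset κ)
    (a b : κ → ℝ)
    (h : ∀ g : ℝ → ℂ, IsWeilTest g → tsupport g ⊆ Icc (-A) A →
      ∑ k ∈ F, weilMellin g (1 / 2 + (a k : ℂ) * I) =
        ∑ k ∈ F, weilMellin g (1 / 2 + (b k : ℂ) * I)) :
    F.val.map a = F.val.map b := by
  classical
  -- the exponential polynomial
  set P : ℝ → ℂ := fun t =>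
    ∑ k ∈ F, cexp ((a k : ℂ) * I * (t : ℂ)) - ∑ k ∈ F, cexp ((b k : ℂ) * I * (t : ℂ)) with hP
  have hPc : Continuous P := by
    simp only [hP]
    fun_prop
  have hPa : AnalyticOnNhd ℝ P univ := by
    simp only [hP]
    refine AnalyticOnNhd.sub ?_ ?_ <;>
      exact Finset.analyticOnNhd_fun_sum _ fun k _ => analyticOnNhd_cexp_mul_I _
  -- (1) `∫ g P = 0` for every real smooth `g` supported in `U = (-A, A)`
  set U : Set ℝ := Ioo (-A) A with hU
  have hUo : IsOpen U := isOpen_Ioo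
  have h0U : (0 : ℝ) ∈ U := ⟨by linarith, hA⟩
  have hint : ∀ g : ℝ → ℝ, ContDiff ℝ ∞ g → HasCompactSupport g → tsupport g ⊆ U →
      ∫ t, g t • P t = 0 := by
    intro g hg hgc hgs
    set gc : ℝ → ℂ := fun t => ((g t : ℝ) : ℂ) with hgc_def
    have hgcW : IsWeilTest gc :=
      ⟨Complex.ofRealCLM.contDiff.comp hg, hgc.comp_left Complex.ofReal_zero⟩
    have hgcs : tsupport gc ⊆ Icc (-A) A :=
      ((tsupport_comp_subset Complex.ofReal_zero _).trans hgs).trans Ioo_subset_Icc_self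
    have h1 := h gc hgcW hgcs
    rw [sum_weilMellin_half_eq_integral hgcW, sum_weilMellin_half_eq_integral hgcW] at h1
    have hi : ∀ c : κ → ℝ, Integrable fun t : ℝ =>
        gc t * ∑ k ∈ F, cexp ((c k : ℂ) * I * (t : ℂ)) := fun c =>
      (hgcW.1.continuous.mul (by fun_prop)).integrable_of_hasCompactSupport hgcW.2.mul_right
    calc ∫ t, g t • P t = ∫ t, (gc t * ∑ k ∈ F, cexp ((a k : ℂ) * I * (t : ℂ)) -
          gc t * ∑ k ∈ F, cexp ((b k : ℂ) * I * (t : ℂ))) := by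
          refine integral_congr_ae (Eventually.of_forall fun t => ?_)
          simp only [hP, hgc_def, Complex.real_smul, mul_sub]
      _ = 0 := by rw [integral_sub (hi a) (hi b), h1, sub_self]
  -- (2) `P = 0` a.e. on `U`, hence on `U` by continuity
  have hae : ∀ᵐ t ∂volume, t ∈ U → P t = 0 :=
    hUo.ae_eq_zero_of_integral_contDiff_smul_eq_zero
      (hPc.locallyIntegrable.locallyIntegrableOn U) hint
  have hPU : ∀ t ∈ U, P t = 0 := by
    by_contra hne
    push Not at hne
    obtain ⟨t₀, ht₀U, ht₀⟩ := hne
    set V : Set ℝ := U ∩ {t | P t ≠ 0} with hV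
    have hVo : IsOpen V := hUo.inter (isOpen_ne_fun hPc continuous_const)
    have hVpos : 0 < volume V := hVo.measure_pos volume ⟨t₀, ht₀U, ht₀⟩
    have hVnull : volume V = 0 := by
      rw [ae_iff] at hae
      refine measure_mono_null (fun t ht => ?_) hae
      simp only [mem_setOf_eq, Classical.not_imp]
      exact ⟨ht.1, ht.2⟩
    exact hVpos.ne' hVnull
  -- (3) `P = 0` on `ℝ` by analytic continuation
  have hP0 : ∀ t : ℝ, P t = 0 := by
    have hev : P =ᶠ[𝓝 (0 : ℝ)] 0 := eventuallyEq_of_mem (hUo.mem_nhds h0U) fun t ht => hPU t ht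
    have hEq := hPa.eqOn_zero_of_preconnected_of_eventuallyEq_zero isPreconnected_univ
      (mem_univ 0) hev
    exact fun t => hEq (mem_univ t)
  -- (4) regroup by distinct frequencies and apply Dedekind's independence of characters
  set Λ : Finset ℝ := F.image a ∪ F.image b with hΛ
  have haΛ : ∀ k ∈ F, a k ∈ Λ := fun k hk =>
    Finset.mem_union_left _ (Finset.mem_image_of_mem a hk)
  have hbΛ : ∀ k ∈ F, b k ∈ Λ := fun k hk =>
    Finset.mem_union_right _ (Finset.mem_image_of_mem b hk)
  -- multiplicities
  set cA : ℝ → ℕ := fun x => (F.filter fun k => a k = x).card with hcA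
  set cB : ℝ → ℕ := fun x => (F.filter fun k => b k = x).card with hcB
  have hregroup : ∀ (c : κ → ℝ), (∀ k ∈ F, c k ∈ Λ) → ∀ t : ℝ,
      ∑ k ∈ F, cexp ((c k : ℂ) * I * (t : ℂ)) =
        ∑ x ∈ Λ, ((F.filter fun k => c k = x).card : ℂ) * cexp ((x : ℂ) * I * (t : ℂ)) := by
    intro c hc t
    rw [← Finset.sum_fiberwise_of_maps_to' hc (fun x : ℝ => cexp ((x : ℂ) * I * (t : ℂ)))]
    refine Finset.sum_congr rfl fun x _ => ?_
    rw [Finset.sum_const, nsmul_eq_mul]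
  -- the characters
  let χ : ℝ → (Multiplicative ℝ →* ℂ) := fun x =>
    { toFun := fun u => cexp ((x : ℂ) * I * ((Multiplicative.toAdd u : ℝ) : ℂ))
      map_one' := by simp
      map_mul' := fun u v => by
        rw [← Complex.exp_add]
        congr 1
        simp only [toAdd_mul, Complex.ofReal_add]
        ring }
  have hχ : Function.Injective χ := by
    intro x y hxy
    refine eq_of_cexp_mul_I_eq fun t => ?_
    have := DFunLike.congr_fun hxy (Multiplicative.ofAdd t)
    simpa [χ] using this
  have hLI := (linearIndependent_monoidHom (Multiplicative ℝ) ℂ).comp χ hχ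
  have hcoef : ∀ x ∈ Λ, ((cA x : ℂ) - (cB x : ℂ)) = 0 := by
    refine linearIndependent_iff'.1 hLI Λ (fun x => (cA x : ℂ) - (cB x : ℂ)) ?_
    funext u
    simp only [Finset.sum_apply, Pi.smul_apply, Function.comp_apply, smul_eq_mul,
      Pi.zero_apply]
    have h1 := hP0 (Multiplicative.toAdd u)
    simp only [hP, hregroup a haΛ, hregroup b hbΛ, ← Finset.sum_sub_distrib] at h1
    rw [← h1]
    refine Finset.sum_congr rfl fun x _ => ?_
    simp only [χ, MonoidHom.coe_mk, OneHom.coe_mk, hcA, hcB]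
    ring
  -- (5) equal multiplicities everywhere, hence equal multisets
  have hcount : ∀ x : ℝ, cA x = cB x := by
    intro x
    by_cases hx : x ∈ Λ
    · have := hcoef x hx
      rw [sub_eq_zero] at this
      exact_mod_cast this
    · have hA0 : cA x = 0 := by
        simp only [hcA, Finset.card_eq_zero, Finset.filter_eq_empty_iff]
        intro k hk hkx
        exact hx (hkx ▸ haΛ k hk)
      have hB0 : cB x = 0 := by
        simp only [hcB, Finset.card_eq_zero, Finset.filter_eq_empty_iff]
        intro k hk hkx
        exact hx (hkx ▸ hbΛ k hk)
      rw [hA0, hB0]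
  ext x
  rw [Multiset.count_map, Multiset.count_map]
  have e1 : (Multiset.filter (fun k => x = a k) F.val).card = cA x := by
    simp only [hcA, Finset.card_def, Finset.filter_val]
    congr 1
    exact Multiset.filter_congr fun k _ => eq_comm
  have e2 : (Multiset.filter (fun k => x = b k) F.val).card = cB x := by
    simp only [hcB, Finset.card_def, Finset.filter_val]
    congr 1
    exact Multiset.filter_congr fun k _ => eq_comm
  rw [e1, e2, hcount]

/-! ### Window families: finite relocations -/

/-- **Finite relocation keeps the rung only as a permutation.** If two real families
`γ, γ' : ι → ℝ` both reproduce `W` on the Weil tests supported in `[-A, A]` (`A > 0`) and agree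
outside a finite index set `F`, then on `F` they carry the same multiset of atoms. [folklore] -/
theorem multiset_eq_of_finite_moves {A : ℝ} (hA : 0 < A) {ι : Type*} {γ γ' : ι → ℝ}
    (F : Finset ι) (hF : ∀ i ∉ F, γ' i = γ i)
    (h : ∀ g : ℝ → ℂ, IsWeilTest g → tsupport g ⊆ Icc (-A) A →
      HasSum (fun i => weilMellin g (1 / 2 + (γ i : ℂ) * I)) (weilFunctional g))
    (h' : ∀ g : ℝ → ℂ, IsWeilTest g → tsupport g ⊆ Icc (-A) A →
      HasSum (fun i => weilMellin g (1 / 2 + (γ' i : ℂ) * I)) (weilFunctional g)) :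
    F.val.map γ' = F.val.map γ := by
  refine multiset_eq_of_sum_weilMellin_eq hA F γ' γ fun g hg hgs => ?_
  have hd : HasSum (fun i => weilMellin g (1 / 2 + (γ' i : ℂ) * I) -
      weilMellin g (1 / 2 + (γ i : ℂ) * I)) 0 := by
    have h1 := (h' g hg hgs).sub (h g hg hgs)
    rwa [sub_self] at h1
  have hdF : HasSum (fun i => weilMellin g (1 / 2 + (γ' i : ℂ) * I) -
      weilMellin g (1 / 2 + (γ i : ℂ) * I))
      (∑ i ∈ F, (weilMellin g (1 / 2 + (γ' i : ℂ) * I) - weilMellin g (1 / 2 + (γ i : ℂ) * I))) :=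
    hasSum_sum_of_ne_finset_zero fun i hi => by simp [hF i hi]
  have h0 := hdF.unique hd
  rw [Finset.sum_sub_distrib, sub_eq_zero] at h0
  exact h0

/-- Finite relocations preserving a rung are invisible to EVERY function: same trace, same
value, for any `g` whatsoever. [folklore] -/
theorem hasSum_iff_of_finite_moves {A : ℝ} (hA : 0 < A) {ι : Type*} {γ γ' : ι → ℝ}
    (F : Finset ι) (hF : ∀ i ∉ F, γ' i = γ i)
    (h : ∀ g : ℝ → ℂ, IsWeilTest g → tsupport g ⊆ Icc (-A) A →
      HasSum (fun i => weilMellin g (1 / 2 + (γ i : ℂ) * I)) (weilFunctional g))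
    (h' : ∀ g : ℝ → ℂ, IsWeilTest g → tsupport g ⊆ Icc (-A) A →
      HasSum (fun i => weilMellin g (1 / 2 + (γ' i : ℂ) * I)) (weilFunctional g))
    (g : ℝ → ℂ) (c : ℂ) :
    HasSum (fun i => weilMellin g (1 / 2 + (γ' i : ℂ) * I)) c ↔
      HasSum (fun i => weilMellin g (1 / 2 + (γ i : ℂ) * I)) c := by
  have hM := multiset_eq_of_finite_moves hA F hF h h'
  set φ : ℝ → ℂ := fun x => weilMellin g (1 / 2 + (x : ℂ) * I) with hφ
  -- the difference is finitely supported and sums to `0`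
  have e : ∀ δ : ι → ℝ, Multiset.map (fun i => φ (δ i)) F.val =
      Multiset.map φ (Multiset.map δ F.val) := fun δ => by
    rw [Multiset.map_map]; rfl
  have hfin : ∑ i ∈ F, (φ (γ' i) - φ (γ i)) = 0 := by
    rw [Finset.sum_sub_distrib, sub_eq_zero, Finset.sum_eq_multiset_sum,
      Finset.sum_eq_multiset_sum, e γ', e γ, hM]
  have hd : HasSum (fun i => φ (γ' i) - φ (γ i)) 0 := by
    rw [← hfin]
    exact hasSum_sum_of_ne_finset_zero fun i hi => by simp [hF i hi]
  constructor
  · intro hs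
    have := hs.sub hd
    simpa [hφ] using this
  · intro hs
    have := hs.add hd
    simpa [hφ] using this

/-- **Crux form: no step by finitely many moves.** Let `γ` reproduce `W` on the tests supported
in `[-A, A]` but not on those supported in `[-B, B]` (`0 < A ≤ B`; for the step `A = log n`,
`B = log (n+1)`). Then no family `γ'` differing from `γ` at finitely many indices reproduces `W`
on `[-B, B]`. [folklore] -/
theorem no_windowStep_by_finite_moves {A B : ℝ} (hA : 0 < A) (hAB : A ≤ B) {ι : Type*}
    {γ γ' : ι → ℝ} (F : Finset ι) (hF : ∀ i ∉ F, γ' i = γ i)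
    (hAγ : ∀ g : ℝ → ℂ, IsWeilTest g → tsupport g ⊆ Icc (-A) A →
      HasSum (fun i => weilMellin g (1 / 2 + (γ i : ℂ) * I)) (weilFunctional g))
    (hBγ : ¬ ∀ g : ℝ → ℂ, IsWeilTest g → tsupport g ⊆ Icc (-B) B →
      HasSum (fun i => weilMellin g (1 / 2 + (γ i : ℂ) * I)) (weilFunctional g)) :
    ¬ ∀ g : ℝ → ℂ, IsWeilTest g → tsupport g ⊆ Icc (-B) B →
      HasSum (fun i => weilMellin g (1 / 2 + (γ' i : ℂ) * I)) (weilFunctional g) := by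
  intro hBγ'
  have hAγ' : ∀ g : ℝ → ℂ, IsWeilTest g → tsupport g ⊆ Icc (-A) A →
      HasSum (fun i => weilMellin g (1 / 2 + (γ' i : ℂ) * I)) (weilFunctional g) :=
    fun g hg hgs => hBγ' g hg (hgs.trans (Icc_subset_Icc (neg_le_neg hAB) hAB))
  exact hBγ fun g hg hgs =>
    (hasSum_iff_of_finite_moves hA F hF hAγ hAγ' g (weilFunctional g)).1 (hBγ' g hg hgs)

/-- **Crux form: the step cannot be performed below any finite height.** Let `γ` reproduce `W`
on the tests supported in `[-A, A]` but not on those supported in `[-B, B]` (`0 < A ≤ B`). If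
`γ'` agrees with `γ` at every atom of height `|γ_i| > R`, then `γ'` does not reproduce `W` on
`[-B, B]` — the modified atoms form a finite set by local finiteness of window families
(`finite_abs_le_of_windowTrace`). [folklore] -/
theorem no_windowStep_below_height {A B : ℝ} (hA : 0 < A) (hAB : A ≤ B) {ι : Type*}
    {γ γ' : ι → ℝ} (R : ℝ) (hR : ∀ i, R < |γ i| → γ' i = γ i)
    (hAγ : ∀ g : ℝ → ℂ, IsWeilTest g → tsupport g ⊆ Icc (-A) A →
      HasSum (fun i => weilMellin g (1 / 2 + (γ i : ℂ) * I)) (weilFunctional g))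
    (hBγ : ¬ ∀ g : ℝ → ℂ, IsWeilTest g → tsupport g ⊆ Icc (-B) B →
      HasSum (fun i => weilMellin g (1 / 2 + (γ i : ℂ) * I)) (weilFunctional g)) :
    ¬ ∀ g : ℝ → ℂ, IsWeilTest g → tsupport g ⊆ Icc (-B) B →
      HasSum (fun i => weilMellin g (1 / 2 + (γ' i : ℂ) * I)) (weilFunctional g) := by
  have hfin : {i : ι | |γ i| ≤ R}.Finite := finite_abs_le_of_windowTrace hA hAγ R
  refine no_windowStep_by_finite_moves hA hAB hfin.toFinset (fun i hi => hR i ?_) hAγ hBγ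
  rw [Set.Finite.mem_toFinset, mem_setOf_eq, not_le] at hi
  exact hi

end Summit.RiemannHypothesis.RiemannHypothesis.Theorems.WindowStep.Negative

end
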